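import Literature.Computability.Cryptography.PeikertPerturbation
import Literature.Algebra.EuclideanLattices.ScaledInstance
import HarnessLib

/-!
# Peikert's reduction, first component: the NO and YES cases on the `M`-fold copy of the input instance

Topic `Computability/Cryptography` (family `pqc`), sequel of `PeikertPerturbation.lean` (the NO case on a
scaled instance `no_case_scaled`, abstract in the scaled instance `J`, and the YES-case short vector
`exists_int_vector_norm_le`) and of `Literature.Algebra.EuclideanLattices.ScaledInstance` (the `M`-fold copy
`I.scale M` of an integer instance: `L(MB) = M·L(B)`, `‖(MB)~ᵢ‖ = M‖b̃ᵢ‖`, `λ₁(L(MB)) = Mλ₁(L(B))`,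
nonsingularity). It instantiates both at `J = B.scale M` for an instance `(B, d)` of `GapSVP_{ζ,γ}`, so that
the remaining hypothesis `h₁` of `peikert_gapSVPZeta_to_lwe_classical_of_components` (the first component
of Peikert's Thm. 3.1 as a machine) is stated against lemmas whose hypotheses are literally the
`GapSVPZeta.yes/no` promises. Everything is PROVED; no named fact.

## Results

* **`Peikert2009.no_case_scale`** — for a NO instance `(B, d)` of `GapSVP_{ζ,γ}` in the regime of Thm. 3.1
  and `M ≥ 1`: every perturbation `w ∈ ℤⁿ` with `‖w‖ ≤ d'(Md)`, every target `x ≡ w (mod L(MB))` and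
  every rational `r ∈ [r₀, 2r₀]`, `r₀ = q√(2n)/(γMd)`, give an `f`-admissible call `((MB, x), r)` whose only
  admissible answer is `x - w`.
* **`Peikert2009.exists_short_vector_scale`** — for a YES instance (`λ₁(L(B)) ≤ d`): `L(MB)` has a nonzero
  integer vector of norm `≤ M·d` (the shift hidden by the perturbation, `prob_names_perturbation_roundedGaussian_le`).
* `Peikert2009.reduceMod hJ w` — "`w mod B`" as an integer vector (Mathlib's `ZSpan.fract` of the basis of the
  nonsingular instance `J`); **`reduceMod_sub_mem`** (`(w mod B) - w ∈ L(B)`, hypothesis `hxw` of the NO case)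
  and **`reduceMod_add_of_mem`** (`(z + w) mod B = w mod B` for `z ∈ L(B)`, the shift-invariance hypothesis
  `hred` of the YES case).

## References

* C. Peikert, *Public-key cryptosystems from the worst-case shortest vector problem*, STOC 2009; full
  version, proof of Thm. 3.1 (pp. 11–12) and §2 p. 7 ("suitable amount of precision") [Peikert2009].
-/

noncomputable section

open Filter Metric Literature.Computability.Complexity
  Literature.Algebra.EuclideanLattices Literature.Computability.Cryptography
open scoped ENNReal

namespace Literature.Computability.Cryptography

namespace Peikert2009

/-- **The NO case of Thm. 3.1 on the `M`-fold copy of a NO instance.** Let `(B, d) ∈ GapSVPZeta.no ζ γ` have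
dimension `n ≥ 2`, let `M ≥ 1`, and assume the regime of Thm. 3.1 at `n` (`α ∈ (0,1)`,
`γ ≥ 2n/(α√(log n))`, `q ≥ ζ f√(log n)/√n`, `f ≥ 0`, `q ≥ 1`). Then on the scaled instance `MB` (Gram–Schmidt
norms `M‖b̃ᵢ‖ ≥ M`, `λ₁ = Mλ₁(L(B)) > γ·M·d`), for every `w ∈ ℤⁿ` with `‖w‖ ≤ d'(Md) = Md√n/(2√(log n))`,
every `x` with `x - w ∈ L(MB)` and every rational `r` with `r₀ ≤ r ≤ 2r₀`, `r₀ = q√(2n)/(γ·M·d)`: the call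
`((MB, x), r)` is `f`-admissible and its only admissible answer is `x - w` (`no_case_scaled` with
`isNonsingular_scale`, `norm_gramSchmidt_scale`, `minNorm_scale_lattice`). [cite: Peikert2009, Thm. 3.1 proof (NO case, full version p. 12)] -/
theorem no_case_scale {q : ℕ → ℕ} {α f ζ γ : ℕ → ℝ} {p : GapSVPInstance} (hp : p ∈ GapSVPZeta.no ζ γ)
    {M : ℕ} (hM : 1 ≤ M) (hn : 2 ≤ p.1.n) (hα : 0 < α p.1.n) (hα1 : α p.1.n < 1) (hf : 0 ≤ f p.1.n)
    (hq1 : 1 ≤ q p.1.n) (hγ : 2 * p.1.n / (α p.1.n * Real.sqrt (Real.log p.1.n)) ≤ γ p.1.n)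
    (hq : ζ p.1.n * f p.1.n * Real.sqrt (Real.log p.1.n) / Real.sqrt p.1.n ≤ q p.1.n)
    (x w : Fin p.1.n → ℤ)
    (hxw : intVecToEuclidean p.1.n x - intVecToEuclidean p.1.n w ∈ (p.1.scale M).lattice)
    (hw : ‖intVecToEuclidean p.1.n w‖ ≤ perturbRadius p.1.n (M * p.2)) (r : ℚ)
    (hr : q p.1.n * Real.sqrt (2 * p.1.n) / (γ p.1.n * (M * p.2)) ≤ r)
    (hr2 : (r : ℝ) ≤ 2 * (q p.1.n * Real.sqrt (2 * p.1.n) / (γ p.1.n * (M * p.2)))) :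
    BDDAdmissible q α f (⟨p.1.scale M, x⟩, r) ∧
      ∀ v, CVP.IsSolution (fun _ => 1) ⟨p.1.scale M, x⟩ v → v = x - w := by
  obtain ⟨⟨hI, -, hGS, hd1, hdζ⟩, hno⟩ := hp
  have hM0 : M ≠ 0 := by omega
  have hMr : (1 : ℝ) ≤ M := by exact_mod_cast hM
  have hMpos : (0 : ℝ) < M := by linarith
  have hγpos : 0 < γ p.1.n := by
    have hLpos : 0 < Real.sqrt (Real.log p.1.n) := lt_trans (by norm_num) (half_lt_sqrt_log hn)
    have : 0 < 2 * (p.1.n : ℝ) / (α p.1.n * Real.sqrt (Real.log p.1.n)) :=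
      div_pos (by positivity) (mul_pos hα hLpos)
    exact this.trans_le hγ
  refine no_case_scaled (p.1.scale M) (LatticeInstance.isNonsingular_scale hM0 hI) hMr ?_ ?_ ?_ ?_
    hn hα hα1 hf hq1 hγ hq x w hxw hw r hr hr2
  · -- `M ≤ M·d`
    simpa using mul_le_mul_of_nonneg_left hd1 hMpos.le
  · -- Gram–Schmidt norms of `MB` are `M‖b̃ᵢ‖ ≥ M`
    intro i
    rw [LatticeInstance.norm_gramSchmidt_scale hM0]
    simpa using mul_le_mul_of_nonneg_left (hGS i) hMpos.le
  · -- `γ·(M d) < λ₁(L(MB)) = M λ₁(L(B))`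
    rw [LatticeInstance.minNorm_scale_lattice hM0]
    calc γ p.1.n * (M * (p.2 : ℝ)) = M * (γ p.1.n * p.2) := by ring
      _ < M * minNorm p.1.lattice := mul_lt_mul_of_pos_left hno hMpos
  · -- `M d ≤ M ζ/γ`
    calc (M : ℝ) * p.2 ≤ M * (ζ p.1.n / γ p.1.n) := mul_le_mul_of_nonneg_left hdζ hMpos.le
      _ = M * ζ p.1.n / γ p.1.n := by ring

/-- **YES instances: the shift to hide on the `M`-fold copy.** If `(B, d)` is a YES instance of `GapSVP_{ζ,γ}`
(`λ₁(L(B)) ≤ d`) of dimension `n ≥ 1` and `M ≥ 1`, then `L(MB)` contains a nonzero integer vector of norm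
`≤ M·d` (namely `M` times a shortest vector of `L(B)`); this is the `z` of the YES-case analysis, hidden by a
perturbation of width `σ(Md)` with advantage `≥ 1/(9n¹²)` (`prob_names_perturbation_roundedGaussian_le`,
`inv_poly_le_hiding_advantage`). [cite: Peikert2009, Thm. 3.1 proof (YES case, full version p. 12)] -/
theorem exists_short_vector_scale {ζ γ : ℕ → ℝ} {p : GapSVPInstance} (hp : p ∈ GapSVPZeta.yes ζ γ) {M : ℕ}
    (hM : 1 ≤ M) (hn : 1 ≤ p.1.n) :
    ∃ z : Fin p.1.n → ℤ, z ≠ 0 ∧ intVecToEuclidean p.1.n z ∈ (p.1.scale M).lattice ∧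
      ‖intVecToEuclidean p.1.n z‖ ≤ M * (p.2 : ℝ) := by
  obtain ⟨⟨hI, -, -, -, -⟩, hyes⟩ := hp
  have hM0 : M ≠ 0 := by omega
  refine exists_int_vector_norm_le (J := p.1.scale M) (LatticeInstance.isNonsingular_scale hM0 hI) hn ?_
  rw [LatticeInstance.minNorm_scale_lattice hM0]
  exact mul_le_mul_of_nonneg_left hyes (by positivity)

/-! ### `w mod B`: the canonical representative of a perturbation -/

/-- The fundamental-parallelepiped representative of an integer vector modulo a nonsingular integer
lattice is again an integer vector: `fract_B(w) ∈ ℤⁿ` for `w ∈ ℤⁿ` (it differs from `w` by a lattice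
vector, which is integral). [folklore] -/
theorem exists_intVec_eq_fract {J : LatticeInstance} (hJ : J.IsNonsingular) (w : Fin J.n → ℤ) :
    ∃ x : Fin J.n → ℤ, intVecToEuclidean J.n x =
      ZSpan.fract (LatticeInstance.basisOfIsNonsingular hJ) (intVecToEuclidean J.n w) := by
  set b := LatticeInstance.basisOfIsNonsingular hJ with hb
  have hfloor : ((ZSpan.floor b (intVecToEuclidean J.n w) : EuclideanSpace ℝ (Fin J.n))) ∈ J.lattice := by
    rw [J.lattice_eq_span_basisOfIsNonsingular hJ]
    exact (ZSpan.floor b (intVecToEuclidean J.n w)).2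
  have hint : ZSpan.fract b (intVecToEuclidean J.n w) ∈ stdIntLattice J.n := by
    rw [ZSpan.fract_apply]
    exact Submodule.sub_mem _ (intVecToEuclidean_mem_stdIntLattice _ _) (J.lattice_le_stdIntLattice hfloor)
  have hcoord := (mem_stdIntLattice_iff _).1 hint
  choose x hx using hcoord
  refine ⟨x, ?_⟩
  ext j
  rw [intVecToEuclidean_apply]
  exact hx j

/-- LOCAL GLUE. **`w mod B`**: the integer vector in the fundamental parallelepiped of the basis of the
nonsingular instance `J` congruent to `w` modulo `L(J)` (Peikert 2009, proof of Thm. 3.1, step 1: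
"let `x = w mod B`"; Mathlib's `ZSpan.fract`). [cite: Peikert2009, Thm. 3.1 proof (step 1, full version p. 12)] -/
def reduceMod {J : LatticeInstance} (hJ : J.IsNonsingular) (w : Fin J.n → ℤ) : Fin J.n → ℤ :=
  (exists_intVec_eq_fract hJ w).choose

/-- `w mod B` read in `ℝⁿ` is `fract_B(w)`. [folklore] -/
theorem intVecToEuclidean_reduceMod {J : LatticeInstance} (hJ : J.IsNonsingular) (w : Fin J.n → ℤ) :
    intVecToEuclidean J.n (reduceMod hJ w) =
      ZSpan.fract (LatticeInstance.basisOfIsNonsingular hJ) (intVecToEuclidean J.n w) :=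
  (exists_intVec_eq_fract hJ w).choose_spec

/-- **`(w mod B) - w ∈ L(B)`** — the hypothesis `hxw` of `no_case_scale` / `no_case_scaled` for the target
`x = w mod B`. [cite: Peikert2009, Thm. 3.1 proof (NO case: "because `x - w ∈ Λ`", full version p. 12)] -/
theorem reduceMod_sub_mem {J : LatticeInstance} (hJ : J.IsNonsingular) (w : Fin J.n → ℤ) :
    intVecToEuclidean J.n (reduceMod hJ w) - intVecToEuclidean J.n w ∈ J.lattice := by
  rw [intVecToEuclidean_reduceMod, ZSpan.fract_apply, sub_sub_cancel_left, J.lattice_eq_span_basisOfIsNonsingular hJ]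
  exact Submodule.neg_mem _ (ZSpan.floor _ _).2

/-- **`w mod B` only depends on `w` modulo the lattice**: `(z + w) mod B = w mod B` for integer `z ∈ L(B)` —
the shift-invariance hypothesis `hred` of `prob_names_perturbation_roundedGaussian_le` ("`x' = z + w = w mod B`,
so `x'` is distributed identically to `x`", full version p. 12). [cite: Peikert2009, Thm. 3.1 proof (YES case, full version p. 12)] -/
theorem reduceMod_add_of_mem {J : LatticeInstance} (hJ : J.IsNonsingular) (z w : Fin J.n → ℤ)
    (hz : intVecToEuclidean J.n z ∈ J.lattice) : reduceMod hJ (z + w) = reduceMod hJ w := by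
  apply intVecToEuclidean_injective J.n
  rw [intVecToEuclidean_reduceMod, intVecToEuclidean_reduceMod, map_add]
  refine ZSpan.fract_zSpan_add _ _ ?_
  rw [← J.lattice_eq_span_basisOfIsNonsingular hJ]
  exact hz

end Peikert2009

end Literature.Computability.Cryptography

end
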